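import Summits.QuantumFields.GaugeBoot.BootstrapZeroCouplingSlack
import Summits.QuantumFields.GaugeBoot.ConicFeasibleStability
import Summits.QuantumFields.GaugeBoot.RowPencil
import HarnessLib

/-!
# The level-`n` row space as an affine pencil in `β`; the truncated bootstrap as a parametric conic program (gauge-boot, L1/L4 supplement)

HONEST FRAMING (cell `pub-gaugeboot`, page 1 of every file): the venture produces certified bounds
on lattice expectations at stated coupling, gauge group, dimension and torus size; NOT a mass gap,
NOT a continuum limit, NOT a string tension; NOT Yang–Mills-summit-bearing (barriers
`FixedCouplingUltralocality`, `PerturbativeInvisibility`). Structural; it certifies no number.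

## Content (bookkeeping for `BootstrapValueContinuity.lean`)

* `pairSet r k S V` — the PAIRS `(f', f S_i')` behind the row elements `f' - β • (f S_i')`;
  `rowSet_eq_image_pairSet`, ★ `rowSpace_eq_map_pairSpan` — the level-`V` row space at coupling
  `β` is the image of the `β`-INDEPENDENT pair span under `(x, y) ↦ x - β y`: an affine pencil
  (`rowSpace_eq_pencilRange`, in the language of `RowPencil.lean`);
* ★ `isBootstrapFeasible_iff_mem_feasible` — level-`V` feasibility IS membership in the conic
  feasible set `ConicStability.Feasible (sosCone V) 1 (rowSpace β V)`; `levelValues` as the image;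
* `apply_nonneg_of_mem_sosCone` (SOS elements are pointwise `≥ 0`), `abs_apply_le_of_mem_sosCone`
  (domination of a functional on squares extends to the SOS cone);
* `SU(N)` torus: `finiteDimensional_pairSpanSuN` (the pairs of level `n` live in
  `V_n × V_{n+4}`), `rowSpaceSuN_eq_pencilRange`, `levelValuesSuN_eq_image_feasible`.

References: V. Kazakov, Z. Zheng, arXiv:2203.11360 §2 (the rows); Gantmacher, Theory of Matrices
II, Ch. XII. Folklore.
-/

noncomputable section

open MeasureTheory Filter Topology NormedSpace
open Literature.MathematicalPhysics.QuantumFieldTheory (LatticeRep Edge GaugeConfig wilsonAction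
  wilsonMeasure isProbabilityMeasure_wilsonMeasure)
open Literature.MathematicalPhysics.QuantumLattice

namespace Summit.QuantumFields.GaugeBoot

/-! ## Pairs behind the rows -/

section Pairs

variable {ι : Type*} [DecidableEq ι] {G : Type*} [Group G] [TopologicalSpace G] (r : LatticeRep G)
  {K : Type*} (k : K → ℝ → G) (S : ι → (ι → G) → ℝ)

/-- **The pairs** `(f', f S_i')` (test function `f ∈ V`, link `i`, direction `a`; `f'`, `S_i'` the
polynomial shift derivatives) whose combinations `f' - β • (f S_i')` are the level-`V` row
elements at coupling `β`. Independent of `β`. [folklore] -/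
def pairSet (V : Set C(ι → G, ℝ)) : Set (C(ι → G, ℝ) × C(ι → G, ℝ)) :=
  {p | ∃ (i : ι) (a : K) (f f' S' : C(ι → G, ℝ)), f ∈ V ∧ f' ∈ polyAlgebra (ι := ι) r ∧
    S' ∈ polyAlgebra (ι := ι) r ∧
    (∀ U, HasDerivAt (fun t => S i (Function.update U i (k a t * U i))) (S' U) 0) ∧
    (∀ U, HasDerivAt (fun t => f (Function.update U i (k a t * U i))) (f' U) 0) ∧ (f', f * S') = p}

/-- **The pencil map** `(x, y) ↦ x - β y`. -/
def pencilMap (β : ℝ) : (C(ι → G, ℝ) × C(ι → G, ℝ)) →ₗ[ℝ] C(ι → G, ℝ) :=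
  LinearMap.fst ℝ _ _ - β • LinearMap.snd ℝ _ _

variable {k S}

omit [DecidableEq ι] [Group G] in
/-- `pencilMap` evaluated. -/
@[simp] theorem pencilMap_apply (β : ℝ) (p : C(ι → G, ℝ) × C(ι → G, ℝ)) :
    pencilMap (ι := ι) (G := G) β p = p.1 - β • p.2 := rfl

/-- **The row elements are the pencil images of the pairs.** -/
theorem rowSet_eq_image_pairSet (β : ℝ) (V : Set C(ι → G, ℝ)) :
    rowSet r k S β V = pencilMap β '' pairSet r k S V := by
  ext x
  constructor
  · rintro ⟨i, a, f, f', S', hf, hf', hS', hS'd, hf'd, rfl⟩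
    exact ⟨(f', f * S'), ⟨i, a, f, f', S', hf, hf', hS', hS'd, hf'd, rfl⟩, rfl⟩
  · rintro ⟨p, ⟨i, a, f, f', S', hf, hf', hS', hS'd, hf'd, rfl⟩, rfl⟩
    exact ⟨i, a, f, f', S', hf, hf', hS', hS'd, hf'd, rfl⟩

/-- ★ **The row space is the image of the pair span under the pencil map** (an affine pencil of
subspaces in `β`). [folklore] -/
theorem rowSpace_eq_map_pairSpan (β : ℝ) (V : Set C(ι → G, ℝ)) :
    rowSpace r k S β V = (Submodule.span ℝ (pairSet r k S V)).map (pencilMap β) := by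
  rw [rowSpace, rowSet_eq_image_pairSet, Submodule.map_span]

/-- **In the language of `RowPencil`**: with `L₀ = fst`, `L₁ = snd` restricted to the pair span,
`rowSpace β = pencilRange L₀ L₁ β`. -/
theorem rowSpace_eq_pencilRange (β : ℝ) (V : Set C(ι → G, ℝ)) :
    rowSpace r k S β V = RowPencil.pencilRange
      (LinearMap.fst ℝ _ _ ∘ₗ (Submodule.span ℝ (pairSet r k S V)).subtype)
      (LinearMap.snd ℝ _ _ ∘ₗ (Submodule.span ℝ (pairSet r k S V)).subtype) β := by
  rw [rowSpace_eq_map_pairSpan, RowPencil.pencilRange, ← LinearMap.smul_comp, ← LinearMap.sub_comp,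
    LinearMap.range_comp, Submodule.range_subtype]
  rfl

end Pairs

/-! ## The truncated bootstrap as a conic program -/

section Conic

variable {ι : Type*} [DecidableEq ι] [Countable ι] {G : Type*} [Group G] [TopologicalSpace G]
  [IsTopologicalGroup G] [CompactSpace G] [MeasurableSpace G] [BorelSpace G]
  [SecondCountableTopology G] (r : LatticeRep G) {K : Type*}
  {k : K → ℝ → G} {S : ι → (ι → G) → ℝ} {β : ℝ}

omit [Countable ι] [IsTopologicalGroup G] [CompactSpace G] [MeasurableSpace G] [BorelSpace G]
  [SecondCountableTopology G] in
/-- ★ **Level-`V` feasibility is membership in the conic feasible set** with cone `sosCone V`,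
normalisation `φ 1 = 1` and equality constraints "`φ = 0` on the row space" (local actions with
polynomial shift derivatives). [folklore] -/
theorem isBootstrapFeasible_iff_mem_feasible {V : Set C(ι → G, ℝ)}
    (hS : ∀ (i : ι) (a : K), ∃ S' ∈ polyAlgebra (ι := ι) r,
      ∀ U, HasDerivAt (fun t => S i (Function.update U i (k a t * U i))) (S' U) 0)
    {φ : C(ι → G, ℝ) →ₗ[ℝ] ℝ} :
    IsBootstrapFeasible r k S β V φ ↔
      φ ∈ ConicStability.Feasible (sosCone V : Set C(ι → G, ℝ)) 1 (rowSpace r k S β V) := by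
  constructor
  · intro hφ
    exact ⟨hφ.1, fun x hx => nonneg_of_mem_sosCone hφ.2.1 hx,
      fun x hx => hφ.apply_eq_zero_of_mem_rowSpace r hx⟩
  · rintro ⟨h1, hK, hR⟩
    refine isBootstrapFeasible_of_isDualFeasible r hS ⟨fun x hx => ?_, h1⟩
    obtain ⟨σ, hσ, ρ, hρ, rfl⟩ := (mem_certCone_iff r).1 hx
    rw [map_add, hR ρ hρ, add_zero]
    exact hK σ hσ

end Conic

/-! ## Elementary facts on the SOS cone -/

section SOS

variable {ι : Type*} {G : Type*} [TopologicalSpace G]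

/-- **Sums of squares are pointwise non-negative.** -/
theorem apply_nonneg_of_mem_sosCone {V : Set C(ι → G, ℝ)} {x : C(ι → G, ℝ)} (hx : x ∈ sosCone V)
    (U : ι → G) : 0 ≤ x U := by
  induction hx using Submodule.span_induction with
  | mem x hx =>
    obtain ⟨v, -, rfl⟩ := hx
    exact mul_self_nonneg (v U)
  | zero => simp
  | add x y _ _ hx hy => rw [ContinuousMap.add_apply]; exact add_nonneg hx hy
  | smul c x _ hx =>
    rw [show c • x = (c : ℝ) • x from rfl, ContinuousMap.smul_apply, smul_eq_mul]
    exact mul_nonneg c.2 hx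

/-- **Domination on squares extends to the SOS cone**: `|θ (v v)| ≤ C φ₀ (v v)` for `v ∈ V` gives
`|θ x| ≤ C φ₀ x` for every `x ∈ sosCone V`. -/
theorem abs_apply_le_of_mem_sosCone {V : Set C(ι → G, ℝ)} {θ φ₀ : C(ι → G, ℝ) →ₗ[ℝ] ℝ} {C : ℝ}
    (hC : ∀ v ∈ V, |θ (v * v)| ≤ C * φ₀ (v * v)) {x : C(ι → G, ℝ)} (hx : x ∈ sosCone V) :
    |θ x| ≤ C * φ₀ x := by
  induction hx using Submodule.span_induction with
  | mem x hx =>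
    obtain ⟨v, hv, rfl⟩ := hx
    exact hC v hv
  | zero => simp
  | add x y _ _ hx hy =>
    rw [map_add, map_add, mul_add]
    exact (abs_add_le _ _).trans (add_le_add hx hy)
  | smul c x _ hx =>
    rw [show c • x = (c : ℝ) • x from rfl, map_smul, map_smul, smul_eq_mul, smul_eq_mul, abs_mul,
      abs_of_nonneg c.2, mul_left_comm]
    exact mul_le_mul_of_nonneg_left hx c.2

end SOS

/-! ## `SU(N)` on the torus -/

section SuN

variable {d L : ℕ} [NeZero L] (N : ℕ)

/-- **The level-`n` pair span** of the `SU(N)` torus bootstrap. -/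
abbrev pairSpanSuN (n : ℕ) :
    Submodule ℝ (C(GaugeConfig d L (Matrix.specialUnitaryGroup (Fin N) ℂ), ℝ) ×
      C(GaugeConfig d L (Matrix.specialUnitaryGroup (Fin N) ℂ), ℝ)) :=
  Submodule.span ℝ (pairSet (fundamentalLatticeRep N) (suExp N)
    (fun _ : Edge d L => wilsonAction (fundamentalRep (Fin N)))
    (wordTruncation (ι := Edge d L) (fundamentalLatticeRep N) n))

/-- **Level-`n` pairs live in `V_n × V_{n+4}`** (the derivative of a word of length `≤ n` has
length `≤ n`; the action derivatives have length `4`). -/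
theorem pairSet_subset_suN (n : ℕ) :
    pairSet (fundamentalLatticeRep N) (suExp N) (fun _ : Edge d L => wilsonAction (fundamentalRep (Fin N)))
        (wordTruncation (ι := Edge d L) (fundamentalLatticeRep N) n) ⊆
      Set.range (fun p : ↥(Submodule.span ℝ (wordsUpTo (ι := Edge d L) (fundamentalLatticeRep N) n)) ×
          ↥(Submodule.span ℝ (wordsUpTo (ι := Edge d L) (fundamentalLatticeRep N) (n + 4))) =>
        ((p.1 : C(GaugeConfig d L (Matrix.specialUnitaryGroup (Fin N) ℂ), ℝ)),
          (p.2 : C(GaugeConfig d L (Matrix.specialUnitaryGroup (Fin N) ℂ), ℝ)))) := by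
  rintro p ⟨i, a, f, f', S', hf, -, -, hS'd, hf'd, rfl⟩
  have hfd : HasShiftDeriv (suExp N) i a f (sderiv (suExp N) i a f) :=
    hasShiftDeriv_sderiv_of_mem_polyAlgebra (suExp_add N)
      (X := fun X : SuGenerator N => (X : Matrix (Fin N) (Fin N) ℂ)) (rho_suExp N) i a
      (wordTruncation_subset_polyAlgebra _ n hf)
  have he : f' = sderiv (suExp N) i a f := HasShiftDeriv.unique hf'd hfd
  have hf'n : f' ∈ wordTruncation (ι := Edge d L) (fundamentalLatticeRep N) n := by
    rw [he]
    exact mem_wordTruncation_of_mem_wordSpace _ (sderiv_mem_wordSpace (suExp_add N)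
      (X := fun X : SuGenerator N => (X : Matrix (Fin N) (Fin N) ℂ)) (rho_suExp N) i a
      (mem_wordSpace_univ_of_mem_wordTruncation _ hf))
  have hSd : HasShiftDeriv (suExp N) i a (wilsonActionCM (d := d) (L := L) (fundamentalLatticeRep N))
      (torusActionDeriv (fundamentalLatticeRep N) (suExp N) i a) := fun U =>
    hasDerivAt_torusActionDeriv (fundamentalLatticeRep N) (suExp_add N)
      (X := fun X : SuGenerator N => (X : Matrix (Fin N) (Fin N) ℂ)) (rho_suExp N) i a U
  have hSd' : HasShiftDeriv (suExp N) i a (wilsonActionCM (d := d) (L := L) (fundamentalLatticeRep N)) S' :=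
    fun U => hS'd U
  have heS : S' = torusActionDeriv (fundamentalLatticeRep N) (suExp N) i a := HasShiftDeriv.unique hSd' hSd
  have hS4 : S' ∈ wordTruncation (ι := Edge d L) (fundamentalLatticeRep N) 4 := by
    rw [heS]
    exact mem_wordTruncation_of_mem_wordSpace _ (torusActionDeriv_mem (fundamentalLatticeRep N)
      (suExp_add N) (X := fun X : SuGenerator N => (X : Matrix (Fin N) (Fin N) ℂ)) (rho_suExp N) i a)
  exact ⟨(⟨f', hf'n⟩, ⟨f * S', mul_mem_wordTruncation_add _ hf hS4⟩), rfl⟩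

/-- **The level-`n` pair span is finite-dimensional.** -/
instance finiteDimensional_pairSpanSuN (n : ℕ) :
    FiniteDimensional ℝ (pairSpanSuN (d := d) (L := L) N n) := by
  classical
  haveI : FiniteDimensional ℝ ↥(Submodule.span ℝ (wordsUpTo (ι := Edge d L) (fundamentalLatticeRep N) n)) :=
    FiniteDimensional.span_of_finite ℝ (wordsUpTo_finite (fundamentalLatticeRep N) n)
  haveI : FiniteDimensional ℝ ↥(Submodule.span ℝ (wordsUpTo (ι := Edge d L) (fundamentalLatticeRep N) (n + 4))) :=
    FiniteDimensional.span_of_finite ℝ (wordsUpTo_finite (fundamentalLatticeRep N) (n + 4))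
  set T := ((Submodule.span ℝ (wordsUpTo (ι := Edge d L) (fundamentalLatticeRep N) n)).subtype).prodMap
    ((Submodule.span ℝ (wordsUpTo (ι := Edge d L) (fundamentalLatticeRep N) (n + 4))).subtype) with hT
  have hle : pairSpanSuN (d := d) (L := L) N n ≤ LinearMap.range T := by
    refine Submodule.span_le.2 fun p hp => ?_
    obtain ⟨q, rfl⟩ := pairSet_subset_suN N n hp
    exact ⟨q, rfl⟩
  exact Submodule.finiteDimensional_of_le hle

/-- **The level-`n` row space of the `SU(N)` torus bootstrap is an affine pencil in `β`.** -/
theorem rowSpaceSuN_eq_pencilRange (n : ℕ) (β : ℝ) :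
    rowSpace (fundamentalLatticeRep N) (suExp N) (fun _ : Edge d L => wilsonAction (fundamentalRep (Fin N)))
        β (wordTruncation (ι := Edge d L) (fundamentalLatticeRep N) n) =
      RowPencil.pencilRange (LinearMap.fst ℝ _ _ ∘ₗ (pairSpanSuN (d := d) (L := L) N n).subtype)
        (LinearMap.snd ℝ _ _ ∘ₗ (pairSpanSuN (d := d) (L := L) N n).subtype) β :=
  rowSpace_eq_pencilRange (fundamentalLatticeRep N) β _

/-- **The level-`n` feasible values as the image of the conic feasible set.** -/
theorem levelValuesSuN_eq_image_feasible (β : ℝ) (n : ℕ)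
    (P : C(GaugeConfig d L (Matrix.specialUnitaryGroup (Fin N) ℂ), ℝ)) :
    levelValuesSuN (d := d) (L := L) N β n P =
      (fun φ : C(GaugeConfig d L (Matrix.specialUnitaryGroup (Fin N) ℂ), ℝ) →ₗ[ℝ] ℝ => φ P) ''
        ConicStability.Feasible
          (sosCone (wordTruncation (ι := Edge d L) (fundamentalLatticeRep N) n) : Set _) 1
          (rowSpace (fundamentalLatticeRep N) (suExp N)
            (fun _ : Edge d L => wilsonAction (fundamentalRep (Fin N))) β
            (wordTruncation (ι := Edge d L) (fundamentalLatticeRep N) n)) := by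
  ext t
  simp only [levelValuesSuN, Set.mem_setOf_eq, Set.mem_image,
    isBootstrapFeasible_iff_mem_feasible (fundamentalLatticeRep N) (wilsonAction_polyDeriv_suN N)]

end SuN

end Summit.QuantumFields.GaugeBoot

end
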